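import Mathlib
import Summits.ValiantsHypothesis.ValiantsHypothesis.Theorems.StableRankCancellationDesignCounts
import HarnessLib

/-!
# Route StableRankCancellation — escalation, core reduction (helper for item stmt-ValiantsHypothesis-10613)

`Escalation` (stmt-10613) is `MinCutStableRankBound → DesignFlat → NW ∉ VP ℂ` for the bundled
Reed–Solomon design family `m ↦ NW_{q,d,k}`, `q = m+1`, `d = ⌊log₂ q⌋`, `k = ⌊d/2⌋`. This file
proves the CORE REDUCTION, everything except the unpacking of `VP` membership and the final
asymptotic contradiction: from the two hypotheses, for every prime `q = m+1 ≥ 4` and every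
fan-in-two circuit `P` computing `NW_{q,d,k}`,

  `q^{⌊d/3⌋} ≤ (|P| + q)^C · (d+2)^{C d}`      (`escalation_core`)

with the constant `C` of `MinCutStableRankBound`. Ingredients: `NW ≠ 0` and set-multilinear over all
blocks (`designPoly_ne_zero`, `isSetMultilinear_designPoly`); the balanced cut `S` and test vectors
from `MinCutStableRankBound` (`2 ≤ d = log₂ |𝔽_q|`); `DesignFlat` at the same `(S, a, b)`;
cancelling `|aᵀ M_S b|² > 0`; and `⌊d/3⌋ ≤ e = min(k,|S|) + min(k,|Sᶜ|) − k` for a balanced cut.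
What remains for the item: `NW ∈ VP ℂ ⇒ |P| ≤ m^{k₀} + k₀` (`mem_VP_ofFintype_iff_holds`,
`exists_computes_size_eq_complexity`) and `q^{⌊(log₂ q)/3⌋} > (q^{k₀+1} + q)^C (log₂ q + 2)^{C log₂ q}`
for some large prime `q` (`Nat.exists_infinite_primes`).

Honest framing: bookkeeping over OPEN cruxes (`MinCutStableRankBound` is conjectural); nothing here
is progress on VP ≠ VNP.

## References

* N. Kayal, C. Saha, R. Saptharishi, STOC 2014 (the design polynomial). [cite: KayalSahaSaptharishi2014, §1]
* N. Nisan, A. Wigderson, JCSS 49 (1994) (polynomial designs). [cite: NisanWigderson1994, §2]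
-/

set_option linter.dupNamespace false

noncomputable section

open Finset MvPolynomial

namespace Summit.ValiantsHypothesis.ValiantsHypothesis.Theorems.StableRankCancellationEscalation

open Literature.Computability.AlgebraicComplexity

section Design

variable {q : ℕ} [Fact q.Prime] {d k : ℕ}

/-- The design polynomial as a sum of monomials. [folklore] -/
theorem designPoly_eq_sum_monomial :
    (∑ cf : Fin k → ZMod q, ∏ j : Fin d,
        (X (⟨j, ∑ i : Fin k, cf i * ((j : ℕ) : ZMod q) ^ (i : ℕ)⟩ : Σ _ : Fin d, ZMod q) :
          MvPolynomial (Σ _ : Fin d, ZMod q) ℂ)) =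
      ∑ cf : Fin k → ZMod q, monomial (∑ j : Fin d, Finsupp.single
        (⟨j, ∑ i : Fin k, cf i * ((j : ℕ) : ZMod q) ^ (i : ℕ)⟩ : Σ _ : Fin d, ZMod q) 1) 1 := by
  refine sum_congr rfl fun cf _ => ?_
  rw [monomial_sum_one]
  rfl

/-- The design polynomial is set-multilinear over all `d` blocks. [folklore] -/
theorem isSetMultilinear_designPoly :
    IsSetMultilinear Sigma.fst (univ : Finset (Fin d))
      (∑ cf : Fin k → ZMod q, ∏ j : Fin d,
        (X (⟨j, ∑ i : Fin k, cf i * ((j : ℕ) : ZMod q) ^ (i : ℕ)⟩ : Σ _ : Fin d, ZMod q) :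
          MvPolynomial (Σ _ : Fin d, ZMod q) ℂ)) := by
  rw [designPoly_eq_sum_monomial]
  refine IsSetMultilinear.sum Sigma.fst univ fun cf _ => ?_
  unfold IsSetMultilinear
  refine isWeightedHomogeneous_monomial _ _ _ ?_
  rw [map_sum, blockProfile]
  exact sum_congr rfl fun j _ => weight_blockWeight_single _ _ _

/-- The design polynomial is nonzero (the value table of `cf = 0` occurs). [folklore] -/
theorem designPoly_ne_zero :
    (∑ cf : Fin k → ZMod q, ∏ j : Fin d,
        (X (⟨j, ∑ i : Fin k, cf i * ((j : ℕ) : ZMod q) ^ (i : ℕ)⟩ : Σ _ : Fin d, ZMod q) :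
          MvPolynomial (Σ _ : Fin d, ZMod q) ℂ)) ≠ 0 := by
  classical
  rw [designPoly_eq_sum_monomial]
  intro h0
  set μ : (Fin k → ZMod q) → (Σ _ : Fin d, ZMod q) →₀ ℕ := fun cf => ∑ j : Fin d, Finsupp.single
    (⟨j, ∑ i : Fin k, cf i * ((j : ℕ) : ZMod q) ^ (i : ℕ)⟩ : Σ _ : Fin d, ZMod q) 1 with hμ
  have hc := congrArg (coeff (μ 0)) h0
  rw [coeff_sum, coeff_zero] at hc
  simp_rw [coeff_monomial] at hc
  rw [Finset.sum_boole, Nat.cast_eq_zero, Finset.card_eq_zero, Finset.filter_eq_empty_iff] at hc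
  exact hc (mem_univ 0) rfl

end Design

/-- **Core reduction of `Escalation`**: from `MinCutStableRankBound` (constant `C`) and `DesignFlat`,
every fan-in-two circuit `P` for the design polynomial `NW_{q,d,k}` (`q = m+1` prime, `q ≥ 4`,
`d = ⌊log₂ q⌋`, `k = ⌊d/2⌋`) satisfies `q^{⌊d/3⌋} ≤ (|P| + q)^C (d+2)^{Cd}`.
[cite: KayalSahaSaptharishi2014, §1] -/
theorem escalation_core (hX : Theses.StableRankCancellation.MinCutStableRankBound)
    (hDF : Theses.StableRankCancellation.DesignFlat) :
    ∃ C : ℕ, ∀ m : ℕ, (m + 1).Prime → 4 ≤ m + 1 →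
      ∀ P : ArithCircuit ℂ (Σ _ : Fin (Nat.log 2 (m + 1)), ZMod (m + 1)), P.IsFanInTwo →
        P.Computes (∑ cf : Fin (Nat.log 2 (m + 1) / 2) → ZMod (m + 1), ∏ j : Fin (Nat.log 2 (m + 1)),
          (X (⟨j, ∑ i : Fin (Nat.log 2 (m + 1) / 2), cf i * ((j : ℕ) : ZMod (m + 1)) ^ (i : ℕ)⟩ :
            Σ _ : Fin (Nat.log 2 (m + 1)), ZMod (m + 1)) :
            MvPolynomial (Σ _ : Fin (Nat.log 2 (m + 1)), ZMod (m + 1)) ℂ)) →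
        (m + 1) ^ (Nat.log 2 (m + 1) / 3) ≤
          (P.size + (m + 1)) ^ C * (Nat.log 2 (m + 1) + 2) ^ (C * Nat.log 2 (m + 1)) := by
  obtain ⟨C, hC⟩ := hX
  refine ⟨C, fun m hprime h4 P hP2 hPc => ?_⟩
  classical
  haveI : Fact (m + 1).Prime := ⟨hprime⟩
  -- side conditions of the crux
  have hq0 : m + 1 ≠ 0 := by omega
  have hd2 : 2 ≤ Nat.log 2 (m + 1) := by
    rw [Nat.le_log_iff_pow_le (by norm_num) hq0]; norm_num; omega
  have hcard : Fintype.card (ZMod (m + 1)) = m + 1 := ZMod.card (m + 1)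
  have hdα : Nat.log 2 (m + 1) ≤ Nat.log 2 (Fintype.card (ZMod (m + 1))) := by rw [hcard]
  have hkd : Nat.log 2 (m + 1) / 2 ≤ Nat.log 2 (m + 1) := Nat.div_le_self _ 2
  have hdq : Nat.log 2 (m + 1) ≤ m + 1 := Nat.log_le_self 2 _
  -- the balanced cut and the test vectors of `MinCutStableRankBound`
  obtain ⟨S, hS1, hS2, a, b, hne, hbd⟩ := hC (Nat.log 2 (m + 1)) (ZMod (m + 1)) hd2 hdα _ P
    designPoly_ne_zero isSetMultilinear_designPoly hP2 hPc
  -- `DesignFlat` at the same cut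
  have hflat := hDF m (Nat.log 2 (m + 1)) (Nat.log 2 (m + 1) / 2) hprime hkd hdq S a b
  -- cancel `|aᵀ M b|² > 0`
  have hbil0 := pow_pos (norm_pos_iff.2 hne) 2
  have hle := le_of_mul_le_mul_right (hflat.trans hbd) hbil0
  rw [hcard] at hle
  have hle' : (m + 1) ^ (min (Nat.log 2 (m + 1) / 2) S.card +
      min (Nat.log 2 (m + 1) / 2) (Nat.log 2 (m + 1) - S.card) - Nat.log 2 (m + 1) / 2) ≤
      (P.size + (m + 1)) ^ C * (Nat.log 2 (m + 1) + 2) ^ (C * Nat.log 2 (m + 1)) := by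
    exact_mod_cast hle
  -- `⌊d/3⌋ ≤ e` for a balanced cut
  have hS : S.card ≤ Nat.log 2 (m + 1) := by simpa using S.card_le_univ
  have he : Nat.log 2 (m + 1) / 3 ≤ min (Nat.log 2 (m + 1) / 2) S.card +
      min (Nat.log 2 (m + 1) / 2) (Nat.log 2 (m + 1) - S.card) - Nat.log 2 (m + 1) / 2 := by omega
  exact (Nat.pow_le_pow_right (by omega) he).trans hle'

end Summit.ValiantsHypothesis.ValiantsHypothesis.Theorems.StableRankCancellationEscalation

end
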